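import Summits.BirchSwinnertonDyer.Rank1Residual.P2.CongruentNumberThetaThreePrimesBFamily
import Summits.BirchSwinnertonDyer.Rank1Residual.P2.CongruentNumberThetaThreePrimesCFamily
import Summits.BirchSwinnertonDyer.Rank1Residual.P2.CongruentNumberThetaThreePrimesDFamily
import Summits.BirchSwinnertonDyer.Rank1Residual.P2.CongruentNumberThetaThreePrimesEFamily
import Summits.BirchSwinnertonDyer.Rank1Residual.P2.CongruentNumberEvenAokiMonskyDoors
import HarnessLib
import HarnessLib.Audit.Tags

/-!
# Cell `bsd-monsky` (prover-B): the five explicit `k = 3` families of route B ON AOKI'S THEOREM 2.2 — `ord_{s=1} L = 1`,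
# rank `1`, `Ш[2^∞] = 0`, `BSD(E_{2p₁p₂p₃}, 2)` for the types `(5,5,7)`, `(3,7,7)`, `(3,5,5)`, `(1,5,7)`, `(1,3,5)` relative to
# {`tyz_cmPointGaloisData`, TYZ Thm. 1.1, GZK, `thm22_card_selmerGroup_two`} (kernel theorems; nothing asserted)

HONEST FRAMING (cell `bsd-monsky`, run/shared/lean/pub/bsd-monsky/; README §1/§3): the cell's CLAIMED theorem is Monsky's
1990 conjecture on `𝒮⁻` (`k = 2`); the `k = 3` families below are the README §3 record «what the same argument gives at
`ℓ ≥ 3`», NOT part of the claim, and close no class by themselves.  The family theorems of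
`…ThetaThreePrimesFamily.lean` (`(5,5,7)`), `…ThetaThreePrimesBFamily.lean` (`(3,7,7)`), `…ThetaThreePrimesCFamily.lean`
(`(3,5,5)`), `…ThetaThreePrimesDFamily.lean` (`(1,5,7)`), `…ThetaThreePrimesEFamily.lean` (`(1,3,5)`) take the `2`-Selmer
input as `hMe : monsky_card_selmerGroup_two_even` (Monsky's appendix to Heath-Brown 1994, even case — printed as a sketch).
Since `…EvenAokiMonskyAllPrimes.lean` (Aoki 1999 Thm. 2.2 ≡ Monsky's even matrix count on `n ≡ 6 (mod 8)`, every `k`, a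
kernel theorem) the same conclusions hold with `hAo : Aoki1999.thm22_card_selmerGroup_two` (refereed, complete printed proof)
in place of `hMe`: THIS file re-runs the five families through the uniform even door
`rankOne_sha_bsdp_two_iff_congruentNumberCurve_two_mul_prod_of_aoki` (its `(p, q, r)` form below).  After this file NO
route-B family theorem needs the HB94-even-sketch input: the `k = 3` families rest on {`tyz_cmPointGaloisData` (or the
split display `tyz_cmPointClassFieldData`), `thm11_parity_of_scriptL` (types B–E), GZK, Aoki Thm. 2.2}.  CONDITIONAL;
nothing asserted; no mark moved.
[cite: Aoki1999, Thm. 2.2 (p. 81)] [cite: TianYuanZhang2017, §1 (1.1), Thm. 1.1, Thm. 3.5, §3]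
[cite: HeathBrown1994SelmerCongruentII, Appendix (Monsky), typescript p. 41 L20–L36]
[cite: Miller2011LMS, Def. 1.1 (arXiv:1010.2431 p. 3)]
-/


noncomputable section

open scoped Classical

open Matrix Finset WeierstrassCurve Literature.NumberTheory.EllipticCurves
  Literature.NumberTheory.EllipticCurves.Rank1Residual
  Literature.NumberTheory.EllipticCurves.Rank1Residual.Typed
  Literature.NumberTheory.EllipticCurves.HeathBrown1994
  Literature.NumberTheory.EllipticCurves.Aoki1999
  Literature.NumberTheory.EllipticCurves.Tian2014
  Literature.NumberTheory.EllipticCurves.TianYuanZhang2017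
  Literature.NumberTheory.EllipticCurves.TianYuanZhang2017.W2
  Literature.NumberTheory.QuadraticFields.RedeiReichardt

set_option autoImplicit false

namespace Summit.BirchSwinnertonDyer.Rank1Residual.P2

namespace ThetaDescent

variable {p₁ p₂ p₃ : ℕ}

/-! ## §1 The even `ℓ = 3` door, `(p, q, r)` form, modulo {GZK, hAo} -/

/-- **THE EVEN `ℓ = 3` DOOR, `(p, q, r)` form, with Aoki's Theorem 2.2 as the `2`-Selmer input.** For pairwise distinct
primes `p, q, r` with `2pqr ≡ 6 (mod 8)`, `monskySelmerRankEven ![p, q, r] = 1`, and ANY rank-one datum `L′(E_{2pqr}, 1) =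
x·Ω·Reg`, `x ≠ 0`: `ord_{s=1} L = 1`, rank `1`, `Ш[2^∞] = 0`, and `BSD(E_{2pqr}, 2) ⟺ ord₂ x = 4` — modulo {GZK, hAo} only
(the uniform door `rankOne_sha_bsdp_two_iff_congruentNumberCurve_two_mul_prod_of_aoki` at `k = 3`).
[cite: Aoki1999, Thm. 2.2 (p. 81)] [cite: Miller2011LMS, Def. 1.1 (arXiv:1010.2431 p. 3)] -/
theorem rankOne_sha_bsdp_two_iff_congruentNumberCurve_two_mul_pqr_of_aoki
    (hGZK : rank_eq_analyticRank_of_analyticRank_le_one) (hAo : thm22_card_selmerGroup_two)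
    {p q r : ℕ} (hp : p.Prime) (hq : q.Prime) (hr : r.Prime) (hpq : p ≠ q) (hpr : p ≠ r)
    (hqr : q ≠ r) (h8 : 2 * (p * q * r) % 8 = 6) (hs : monskySelmerRankEven ![p, q, r] = 1)
    {x : ℚ} (hx0 : x ≠ 0)
    (hx : deriv (congruentNumberCurve (2 * (p * q * r))).entireLFunction 1 =
      (x : ℂ) * ((congruentNumberCurve (2 * (p * q * r))).realPeriodRat : ℂ) *
        ((congruentNumberCurve (2 * (p * q * r))).regulator : ℂ)) :
    (congruentNumberCurve (2 * (p * q * r))).analyticRank = 1 ∧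
      (congruentNumberCurve (2 * (p * q * r))).mordellWeilRank = 1 ∧
      AddCommGroup.primaryComponent (congruentNumberCurve (2 * (p * q * r))).sha 2 = ⊥ ∧
      (BSDp (congruentNumberCurve (2 * (p * q * r))) 2 ↔ padicValRat 2 x = 4) := by
  have ht : ∀ i, (![p, q, r] i).Prime := fun i => by fin_cases i <;> assumption
  have hinj : Function.Injective ![p, q, r] := by
    intro i j h
    fin_cases i <;> fin_cases j <;> simp_all
  have hn : 2 * ∏ i, ![p, q, r] i = 2 * (p * q * r) := by rw [Fin.prod_univ_three]; rfl
  obtain ⟨h1, h2, h3, h4⟩ :=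
    rankOne_sha_bsdp_two_iff_congruentNumberCurve_two_mul_prod_of_aoki ![p, q, r] hGZK hAo ht hinj hn h8 hs hx0 hx
  refine ⟨h1, h2, h3, ?_⟩
  rw [h4]
  norm_num

/-! ## §2 Type `(5, 5, 7)` -/

/-- **Type `(5, 5, 7)`, `g(n)` odd, `s(n) = 1`: `ord_{s=1} L = 1`, rank `1`, `Ш[2^∞] = 0`, `BSD(E_n, 2)`** relative to
{`tyz_cmPointGaloisData`, GZK, Aoki Thm. 2.2} (the rank-one datum `rankOneDatum_two_mul_557_of_cmPointGaloisData` through the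
Aoki door). CONDITIONAL; nothing asserted. [cite: TianYuanZhang2017, §1 (1.1), Thm. 3.5] [cite: Aoki1999, Thm. 2.2 (p. 81)] -/
theorem rankOne_sha_bsdp_two_two_mul_557_of_cmPointGaloisData_of_aoki (hCM : tyz_cmPointGaloisData)
    (hGZK : rank_eq_analyticRank_of_analyticRank_le_one) (hAo : thm22_card_selmerGroup_two)
    (hp₁ : p₁.Prime) (hp₂ : p₂.Prime) (hp₃ : p₃.Prime) (h₁ : p₁ % 8 = 5) (h₂ : p₂ % 8 = 5) (h₃ : p₃ % 8 = 7)
    (h12 : p₁ ≠ p₂) (hg : Odd (gK (2 * (p₁ * p₂ * p₃)))) (hs : monskySelmerRankEven ![p₁, p₂, p₃] = 1) :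
    (congruentNumberCurve (2 * (p₁ * p₂ * p₃))).analyticRank = 1 ∧
      (congruentNumberCurve (2 * (p₁ * p₂ * p₃))).mordellWeilRank = 1 ∧
      AddCommGroup.primaryComponent (congruentNumberCurve (2 * (p₁ * p₂ * p₃))).sha 2 = ⊥ ∧
      BSDp (congruentNumberCurve (2 * (p₁ * p₂ * p₃))) 2 := by
  have h12m : (p₁ * p₂) % 8 = 1 := by rw [Nat.mul_mod, h₁, h₂]
  have hm7 : (p₁ * p₂ * p₃) % 8 = 7 := by rw [Nat.mul_mod, h12m, h₃]
  have hn6 : (2 * (p₁ * p₂ * p₃)) % 8 = 6 := by omega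
  have h13 : p₁ ≠ p₃ := fun h => by omega
  have h23 : p₂ ≠ p₃ := fun h => by omega
  obtain ⟨-, x, hx0, hv, hx⟩ :=
    rankOneDatum_two_mul_557_of_cmPointGaloisData hCM hGZK hp₁ hp₂ hp₃ h₁ h₂ h₃ h12 hg
  obtain ⟨hr1, hrk, hsha, hiff⟩ :=
    rankOne_sha_bsdp_two_iff_congruentNumberCurve_two_mul_pqr_of_aoki hGZK hAo hp₁ hp₂ hp₃ h12 h13 h23 hn6 hs hx0 hx
  exact ⟨hr1, hrk, hsha, hiff.mpr hv⟩

/-- **The `(5, 5, 7)` family on Aoki's theorem**: for primes `p₁ ≡ p₂ ≡ 5`, `p₃ ≡ 7 (mod 8)`, `p₁ ≠ p₂`, `(p₁p₂/p₃) = −1`: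
`ord_{s=1} L = 1`, rank `1`, `Ш[2^∞] = 0`, `BSD(E_{2p₁p₂p₃}, 2)`, relative to {`tyz_cmPointGaloisData`, GZK, Aoki Thm. 2.2}.
CONDITIONAL; nothing asserted; closes no class by itself. [cite: TianYuanZhang2017, §1 (1.1), Thm. 3.5, §3] [cite: Aoki1999, Thm. 2.2 (p. 81)] -/
theorem rankOne_sha_bsdp_two_two_mul_557_family_of_aoki (hCM : tyz_cmPointGaloisData)
    (hGZK : rank_eq_analyticRank_of_analyticRank_le_one) (hAo : thm22_card_selmerGroup_two) :
    ∀ p₁ p₂ p₃ : ℕ, p₁.Prime → p₂.Prime → p₃.Prime → p₁ % 8 = 5 → p₂ % 8 = 5 → p₃ % 8 = 7 → p₁ ≠ p₂ →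
      jacobiSym ((p₁ : ℤ) * p₂) p₃ = -1 →
      (congruentNumberCurve (2 * (p₁ * p₂ * p₃))).analyticRank = 1 ∧
        (congruentNumberCurve (2 * (p₁ * p₂ * p₃))).mordellWeilRank = 1 ∧
        AddCommGroup.primaryComponent (congruentNumberCurve (2 * (p₁ * p₂ * p₃))).sha 2 = ⊥ ∧
        BSDp (congruentNumberCurve (2 * (p₁ * p₂ * p₃))) 2 :=
  fun _ _ _ hp₁ hp₂ hp₃ h₁ h₂ h₃ h12 hj =>
    rankOne_sha_bsdp_two_two_mul_557_of_cmPointGaloisData_of_aoki hCM hGZK hAo hp₁ hp₂ hp₃ h₁ h₂ h₃ h12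
      (odd_gK_two_mul_557 hp₁ hp₂ hp₃ h₁ h₂ h₃ h12 hj) (monskySelmerRankEven_557 hp₁ hp₂ hp₃ h₁ h₂ h₃ h12)

/-! ## §3 Type `(3, 7, 7)` -/

/-- **The rank-one datum of the type `(3, 7, 7)` with `g(n)` odd** (stated here; `…ThetaThreePrimesBFamily.lean` builds it
inline): `ord_{s=1} L(E_n, s) = 1` and `L′(E_n, 1) = x·Ω·Reg` with `x = 2⁴·𝓛²`, `𝓛` odd, `ord₂ x = 4`. Relative to
{`tyz_cmPointGaloisData`, TYZ Thm. 1.1, GZK}; nothing asserted. [cite: TianYuanZhang2017, §1 ((1.1), p0002 L63–L75), Thm. 1.1] -/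
theorem rankOneDatum_two_mul_377 (hCM : tyz_cmPointGaloisData) (h11 : thm11_parity_of_scriptL)
    (hGZK : rank_eq_analyticRank_of_analyticRank_le_one) (hp₁ : p₁.Prime) (hp₂ : p₂.Prime) (hp₃ : p₃.Prime)
    (h₁ : p₁ % 8 = 3) (h₂ : p₂ % 8 = 7) (h₃ : p₃ % 8 = 7) (h23 : p₂ ≠ p₃) (hg : Odd (gK (2 * (p₁ * p₂ * p₃)))) :
    (congruentNumberCurve (2 * (p₁ * p₂ * p₃))).analyticRank = 1 ∧
    ∃ x : ℚ, x ≠ 0 ∧ padicValRat 2 x = 4 ∧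
      deriv (congruentNumberCurve (2 * (p₁ * p₂ * p₃))).entireLFunction 1 =
        (x : ℂ) * ((congruentNumberCurve (2 * (p₁ * p₂ * p₃))).realPeriodRat : ℂ) *
          ((congruentNumberCurve (2 * (p₁ * p₂ * p₃))).regulator : ℂ) := by
  have hsq := squarefree_two_mul_377 hp₁ hp₂ hp₃ h₁ h₂ h₃ h23
  haveI := isElliptic_congruentNumberCurve hsq.ne_zero
  have h12m : (p₁ * p₂) % 8 = 5 := by rw [Nat.mul_mod, h₁, h₂]
  have hm3 : (p₁ * p₂ * p₃) % 8 = 3 := by rw [Nat.mul_mod, h12m, h₃]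
  have hn6 : (2 * (p₁ * p₂ * p₃)) % 8 = 6 := by omega
  obtain ⟨D, hD, hG⟩ := hCM _ hsq (Or.inr (Or.inl hn6))
  have hL : IsScriptL _ (D.scriptL (2 * (p₁ * p₂ * p₃))) := hD.1 _ (Nat.mem_divisors_self _ hsq.ne_zero) (by omega)
  set L := D.scriptL (2 * (p₁ * p₂ * p₃)) with hLdef
  have hLodd : Odd L := by
    refine odd_scriptL_two_mul_377 h11 hp₁ hp₂ hp₃ h₁ h₂ h₃ h23 D hD hG (fun hL0 => ?_) hg
    have har := S4 hsq (Or.inr (Or.inl hn6)) hL hL0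
    rw [(hGZK (congruentNumberCurve _) har).1]; exact har
  have hL0' : L ≠ 0 := fun h => by simp [h] at hLodd
  have hL0 : (L : ℚ) ≠ 0 := by exact_mod_cast hL0'
  have hr1 := analyticRank_congruentNumberCurve_eq_one_of_isScriptL hsq (Or.inr (Or.inl hn6)) hL hL0'
  have ht : ∀ i, ((![p₁, p₂, p₃] : Fin 3 → ℕ) i).Prime := fun i => by fin_cases i <;> assumption
  have hodd : ∀ i, Odd ((![p₁, p₂, p₃] : Fin 3 → ℕ) i) := fun i => by
    fin_cases i <;> exact Nat.odd_iff.mpr (by simp; omega)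
  have hinj : Function.Injective (![p₁, p₂, p₃] : Fin 3 → ℕ) := by
    intro i j h
    fin_cases i <;> fin_cases j <;> simp_all
  have he : twoExponent (2 * (p₁ * p₂ * p₃)) = 4 := by
    have h := twoExponent_two_mul_prod_eq _ ht hodd hinj
    rw [Fin.prod_univ_three] at h
    norm_num at h
    exact h
  refine ⟨hr1, (2 : ℚ) ^ twoExponent (2 * (p₁ * p₂ * p₃)) * (L : ℚ) ^ 2,
    mul_ne_zero (zpow_ne_zero _ two_ne_zero) (pow_ne_zero _ hL0), ?_, ?_⟩
  · rw [padicValRat_two_zpow_mul_sq hLodd, he]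
  · rw [← (leadingLCoeff_eq_deriv_of_analyticRank_eq_one hr1).1,
      leadingLCoeff_congruentNumberCurve_eq_of_isScriptL (Nat.pos_of_ne_zero hsq.ne_zero) hr1 hL]
    push_cast
    ring

/-- **The `(3, 7, 7)` SILENT family on Aoki's theorem**: for primes `p₁ ≡ 3`, `p₂ ≡ p₃ ≡ 7 (mod 8)`, `p₂ ≠ p₃`, `(p₂p₃/p₁) = −1`,
`(p₃/p₂) = (p₂/p₁)`: `ord_{s=1} L = 1`, rank `1`, `Ш[2^∞] = 0`, `BSD(E_{2p₁p₂p₃}, 2)`, relative to {`tyz_cmPointGaloisData`,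
TYZ Thm. 1.1, GZK, Aoki Thm. 2.2}. CONDITIONAL; nothing asserted; closes no class by itself.
[cite: TianYuanZhang2017, Thm. 1.1, §1 (1.1), Thm. 3.5, §3] [cite: Aoki1999, Thm. 2.2 (p. 81)] -/
theorem rankOne_sha_bsdp_two_two_mul_377_family_of_aoki (hCM : tyz_cmPointGaloisData) (h11 : thm11_parity_of_scriptL)
    (hGZK : rank_eq_analyticRank_of_analyticRank_le_one) (hAo : thm22_card_selmerGroup_two) :
    ∀ p₁ p₂ p₃ : ℕ, p₁.Prime → p₂.Prime → p₃.Prime → p₁ % 8 = 3 → p₂ % 8 = 7 → p₃ % 8 = 7 → p₂ ≠ p₃ →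
      jacobiSym ((p₂ : ℤ) * p₃) p₁ = -1 → jacobiSym (p₃ : ℤ) p₂ = jacobiSym (p₂ : ℤ) p₁ →
      (congruentNumberCurve (2 * (p₁ * p₂ * p₃))).analyticRank = 1 ∧
        (congruentNumberCurve (2 * (p₁ * p₂ * p₃))).mordellWeilRank = 1 ∧
        AddCommGroup.primaryComponent (congruentNumberCurve (2 * (p₁ * p₂ * p₃))).sha 2 = ⊥ ∧
        BSDp (congruentNumberCurve (2 * (p₁ * p₂ * p₃))) 2 := by
  intro p₁ p₂ p₃ hp₁ hp₂ hp₃ h₁ h₂ h₃ h23 hj hk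
  have h12 : p₁ ≠ p₂ := fun h => by omega
  have h13 : p₁ ≠ p₃ := fun h => by omega
  have h12m : (p₁ * p₂) % 8 = 5 := by rw [Nat.mul_mod, h₁, h₂]
  have hm3 : (p₁ * p₂ * p₃) % 8 = 3 := by rw [Nat.mul_mod, h12m, h₃]
  have hn6 : (2 * (p₁ * p₂ * p₃)) % 8 = 6 := by omega
  obtain ⟨hbits, hs0⟩ := bits_377_of_jacobiSym hp₁ hp₂ hp₃ h₁ h₂ h₃ h23 hj hk
  have hg : Odd (gK (2 * (p₁ * p₂ * p₃))) := (odd_gK_two_mul_377_iff_bits hp₁ hp₂ hp₃ h₁ h₂ h₃ h23).mpr hbits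
  have hs : monskySelmerRankEven ![p₁, p₂, p₃] = 1 := monskySelmerRankEven_377 hp₁ hp₂ hp₃ h₁ h₂ h₃ h23 hs0
  obtain ⟨-, x, hx0, hv, hx⟩ := rankOneDatum_two_mul_377 hCM h11 hGZK hp₁ hp₂ hp₃ h₁ h₂ h₃ h23 hg
  obtain ⟨hr1, hrk, hsha, hiff⟩ :=
    rankOne_sha_bsdp_two_iff_congruentNumberCurve_two_mul_pqr_of_aoki hGZK hAo hp₁ hp₂ hp₃ h12 h13 h23 hn6 hs hx0 hx
  exact ⟨hr1, hrk, hsha, hiff.mpr hv⟩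

/-! ## §4 Type `(3, 5, 5)` -/

/-- **Type `(3, 5, 5)`, `g(n)` odd: `ord_{s=1} L = 1`, rank `1`, `Ш[2^∞] = 0`, `BSD(E_n, 2)`** relative to {`tyz_cmPointGaloisData`,
TYZ Thm. 1.1, GZK, Aoki Thm. 2.2} (`rankOneDatum_two_mul_355` through the Aoki door; `s(n) = 1` kernel-decided on the type).
CONDITIONAL; nothing asserted. [cite: TianYuanZhang2017, §1 (1.1), Thm. 1.1, Thm. 3.5] [cite: Aoki1999, Thm. 2.2 (p. 81)] -/
theorem rankOne_sha_bsdp_two_two_mul_355_of_aoki (hCM : tyz_cmPointGaloisData) (h11 : thm11_parity_of_scriptL)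
    (hGZK : rank_eq_analyticRank_of_analyticRank_le_one) (hAo : thm22_card_selmerGroup_two)
    (hp₁ : p₁.Prime) (hp₂ : p₂.Prime) (hp₃ : p₃.Prime) (h₁ : p₁ % 8 = 3) (h₂ : p₂ % 8 = 5) (h₃ : p₃ % 8 = 5)
    (h23 : p₂ ≠ p₃)
    (hbits : kroneckerBit p₂ p₁ * kroneckerBit p₃ p₁ + kroneckerBit p₂ p₁ * kroneckerBit p₃ p₂ +
      kroneckerBit p₃ p₁ * kroneckerBit p₃ p₂ = 0) :
    (congruentNumberCurve (2 * (p₁ * p₂ * p₃))).analyticRank = 1 ∧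
      (congruentNumberCurve (2 * (p₁ * p₂ * p₃))).mordellWeilRank = 1 ∧
      AddCommGroup.primaryComponent (congruentNumberCurve (2 * (p₁ * p₂ * p₃))).sha 2 = ⊥ ∧
      BSDp (congruentNumberCurve (2 * (p₁ * p₂ * p₃))) 2 := by
  have hn6 := two_mul_355_mod_eight h₁ h₂ h₃
  have h12 : p₁ ≠ p₂ := fun h => by omega
  have h13 : p₁ ≠ p₃ := fun h => by omega
  obtain ⟨-, x, hx0, hv, hx⟩ := rankOneDatum_two_mul_355 hCM h11 hGZK hp₁ hp₂ hp₃ h₁ h₂ h₃ h23 hbits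
  obtain ⟨hr1, hrk, hsha, hiff⟩ :=
    rankOne_sha_bsdp_two_iff_congruentNumberCurve_two_mul_pqr_of_aoki hGZK hAo hp₁ hp₂ hp₃ h12 h13 h23 hn6
      (monskySelmerRankEven_355 hp₁ hp₂ hp₃ h₁ h₂ h₃ h23) hx0 hx
  exact ⟨hr1, hrk, hsha, hiff.mpr hv⟩

/-- **The `(3, 5, 5)` family on Aoki's theorem**: for primes `p₁ ≡ 3`, `p₂ ≡ p₃ ≡ 5 (mod 8)`, `p₂ ≠ p₃`, at least two of
`(p₂/p₁), (p₃/p₁), (p₃/p₂)` equal to `+1`: `ord_{s=1} L = 1`, rank `1`, `Ш[2^∞] = 0`, `BSD(E_{2p₁p₂p₃}, 2)`, relative to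
{`tyz_cmPointGaloisData`, TYZ Thm. 1.1, GZK, Aoki Thm. 2.2}. CONDITIONAL; nothing asserted; closes no class by itself.
[cite: TianYuanZhang2017, §1 (1.1), Thm. 1.1, Thm. 3.5, §3] [cite: Aoki1999, Thm. 2.2 (p. 81)] -/
theorem rankOne_sha_bsdp_two_two_mul_355_family_of_aoki (hCM : tyz_cmPointGaloisData) (h11 : thm11_parity_of_scriptL)
    (hGZK : rank_eq_analyticRank_of_analyticRank_le_one) (hAo : thm22_card_selmerGroup_two) :
    ∀ p₁ p₂ p₃ : ℕ, p₁.Prime → p₂.Prime → p₃.Prime → p₁ % 8 = 3 → p₂ % 8 = 5 → p₃ % 8 = 5 → p₂ ≠ p₃ →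
      ((jacobiSym (p₂ : ℤ) p₁ = 1 ∧ jacobiSym (p₃ : ℤ) p₁ = 1) ∨ (jacobiSym (p₂ : ℤ) p₁ = 1 ∧ jacobiSym (p₃ : ℤ) p₂ = 1) ∨
        (jacobiSym (p₃ : ℤ) p₁ = 1 ∧ jacobiSym (p₃ : ℤ) p₂ = 1)) →
      (congruentNumberCurve (2 * (p₁ * p₂ * p₃))).analyticRank = 1 ∧
        (congruentNumberCurve (2 * (p₁ * p₂ * p₃))).mordellWeilRank = 1 ∧
        AddCommGroup.primaryComponent (congruentNumberCurve (2 * (p₁ * p₂ * p₃))).sha 2 = ⊥ ∧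
        BSDp (congruentNumberCurve (2 * (p₁ * p₂ * p₃))) 2 :=
  fun _ _ _ hp₁ hp₂ hp₃ h₁ h₂ h₃ h23 hj =>
    rankOne_sha_bsdp_two_two_mul_355_of_aoki hCM h11 hGZK hAo hp₁ hp₂ hp₃ h₁ h₂ h₃ h23
      (bits_355_of_jacobiSym hp₁ hp₂ hp₃ h₁ h₂ h₃ h23 hj)

/-! ## §5 Type `(1, 5, 7)` -/

/-- **Type `(1, 5, 7)`, `g(n)` odd: `ord_{s=1} L = 1`, rank `1`, `Ш[2^∞] = 0`, `BSD(E_n, 2)`** relative to {`tyz_cmPointGaloisData`,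
TYZ Thm. 1.1, GZK, Aoki Thm. 2.2}. CONDITIONAL; nothing asserted. [cite: TianYuanZhang2017, §1 (1.1), Thm. 1.1, Thm. 3.5]
[cite: Aoki1999, Thm. 2.2 (p. 81)] -/
theorem rankOne_sha_bsdp_two_two_mul_157_of_aoki (hCM : tyz_cmPointGaloisData) (h11 : thm11_parity_of_scriptL)
    (hGZK : rank_eq_analyticRank_of_analyticRank_le_one) (hAo : thm22_card_selmerGroup_two)
    (hp₁ : p₁.Prime) (hp₂ : p₂.Prime) (hp₃ : p₃.Prime) (h₁ : p₁ % 8 = 1) (h₂ : p₂ % 8 = 5) (h₃ : p₃ % 8 = 7)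
    (hbits : kroneckerBit p₂ p₁ * kroneckerBit p₃ p₁ + kroneckerBit p₂ p₁ * kroneckerBit p₃ p₂ +
      kroneckerBit p₃ p₁ * kroneckerBit p₃ p₂ = 1) :
    (congruentNumberCurve (2 * (p₁ * p₂ * p₃))).analyticRank = 1 ∧
      (congruentNumberCurve (2 * (p₁ * p₂ * p₃))).mordellWeilRank = 1 ∧
      AddCommGroup.primaryComponent (congruentNumberCurve (2 * (p₁ * p₂ * p₃))).sha 2 = ⊥ ∧
      BSDp (congruentNumberCurve (2 * (p₁ * p₂ * p₃))) 2 := by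
  have hn6 := two_mul_157_mod_eight h₁ h₂ h₃
  have h12 : p₁ ≠ p₂ := fun h => by omega
  have h13 : p₁ ≠ p₃ := fun h => by omega
  have h23 : p₂ ≠ p₃ := fun h => by omega
  have key : ∀ a b c : ZMod 2, a * b + a * c + b * c = 1 → a + b + a * b = 1 := by decide
  have hs := monskySelmerRankEven_157 hp₁ hp₂ hp₃ h₁ h₂ h₃ (key _ _ _ hbits)
  obtain ⟨-, x, hx0, hv, hx⟩ := rankOneDatum_two_mul_157 hCM h11 hGZK hp₁ hp₂ hp₃ h₁ h₂ h₃ hbits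
  obtain ⟨hr1, hrk, hsha, hiff⟩ :=
    rankOne_sha_bsdp_two_iff_congruentNumberCurve_two_mul_pqr_of_aoki hGZK hAo hp₁ hp₂ hp₃ h12 h13 h23 hn6 hs hx0 hx
  exact ⟨hr1, hrk, hsha, hiff.mpr hv⟩

/-- **The `(1, 5, 7)` family on Aoki's theorem**: for primes `p₁ ≡ 1`, `p₂ ≡ 5`, `p₃ ≡ 7 (mod 8)`, at least two of
`(p₂/p₁), (p₃/p₁), (p₃/p₂)` equal to `−1`: `ord_{s=1} L = 1`, rank `1`, `Ш[2^∞] = 0`, `BSD(E_{2p₁p₂p₃}, 2)`, relative to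
{`tyz_cmPointGaloisData`, TYZ Thm. 1.1, GZK, Aoki Thm. 2.2}. CONDITIONAL; nothing asserted; closes no class by itself.
[cite: TianYuanZhang2017, §1 (1.1), Thm. 1.1, Thm. 3.5, §3] [cite: Aoki1999, Thm. 2.2 (p. 81)] -/
theorem rankOne_sha_bsdp_two_two_mul_157_family_of_aoki (hCM : tyz_cmPointGaloisData) (h11 : thm11_parity_of_scriptL)
    (hGZK : rank_eq_analyticRank_of_analyticRank_le_one) (hAo : thm22_card_selmerGroup_two) :
    ∀ p₁ p₂ p₃ : ℕ, p₁.Prime → p₂.Prime → p₃.Prime → p₁ % 8 = 1 → p₂ % 8 = 5 → p₃ % 8 = 7 →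
      ((jacobiSym (p₂ : ℤ) p₁ = -1 ∧ jacobiSym (p₃ : ℤ) p₁ = -1) ∨ (jacobiSym (p₂ : ℤ) p₁ = -1 ∧ jacobiSym (p₃ : ℤ) p₂ = -1) ∨
        (jacobiSym (p₃ : ℤ) p₁ = -1 ∧ jacobiSym (p₃ : ℤ) p₂ = -1)) →
      (congruentNumberCurve (2 * (p₁ * p₂ * p₃))).analyticRank = 1 ∧
        (congruentNumberCurve (2 * (p₁ * p₂ * p₃))).mordellWeilRank = 1 ∧
        AddCommGroup.primaryComponent (congruentNumberCurve (2 * (p₁ * p₂ * p₃))).sha 2 = ⊥ ∧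
        BSDp (congruentNumberCurve (2 * (p₁ * p₂ * p₃))) 2 :=
  fun _ _ _ hp₁ hp₂ hp₃ h₁ h₂ h₃ hj =>
    rankOne_sha_bsdp_two_two_mul_157_of_aoki hCM h11 hGZK hAo hp₁ hp₂ hp₃ h₁ h₂ h₃
      (bits_157_of_jacobiSym hp₁ hp₂ hp₃ h₁ h₂ h₃ hj)

/-! ## §6 Type `(1, 3, 5)` -/

/-- **Type `(1, 3, 5)`, `g(n)` odd: `ord_{s=1} L = 1`, rank `1`, `Ш[2^∞] = 0`, `BSD(E_n, 2)`** relative to {`tyz_cmPointGaloisData`,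
TYZ Thm. 1.1, GZK, Aoki Thm. 2.2}. CONDITIONAL; nothing asserted. [cite: TianYuanZhang2017, §1 (1.1), Thm. 1.1, Thm. 3.5]
[cite: Aoki1999, Thm. 2.2 (p. 81)] -/
theorem rankOne_sha_bsdp_two_two_mul_135_of_aoki (hCM : tyz_cmPointGaloisData) (h11 : thm11_parity_of_scriptL)
    (hGZK : rank_eq_analyticRank_of_analyticRank_le_one) (hAo : thm22_card_selmerGroup_two)
    (hp₁ : p₁.Prime) (hp₂ : p₂.Prime) (hp₃ : p₃.Prime) (h₁ : p₁ % 8 = 1) (h₂ : p₂ % 8 = 3) (h₃ : p₃ % 8 = 5)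
    (hbits : kroneckerBit p₂ p₁ + kroneckerBit p₃ p₁ = 1) :
    (congruentNumberCurve (2 * (p₁ * p₂ * p₃))).analyticRank = 1 ∧
      (congruentNumberCurve (2 * (p₁ * p₂ * p₃))).mordellWeilRank = 1 ∧
      AddCommGroup.primaryComponent (congruentNumberCurve (2 * (p₁ * p₂ * p₃))).sha 2 = ⊥ ∧
      BSDp (congruentNumberCurve (2 * (p₁ * p₂ * p₃))) 2 := by
  have hn6 := two_mul_135_mod_eight h₁ h₂ h₃
  have h12 : p₁ ≠ p₂ := fun h => by omega
  have h13 : p₁ ≠ p₃ := fun h => by omega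
  have h23 : p₂ ≠ p₃ := fun h => by omega
  have key : ∀ a b : ZMod 2, a + b = 1 → a + b + a * b = 1 := by decide
  have hs := monskySelmerRankEven_135 hp₁ hp₂ hp₃ h₁ h₂ h₃ (key _ _ hbits)
  obtain ⟨-, x, hx0, hv, hx⟩ := rankOneDatum_two_mul_135 hCM h11 hGZK hp₁ hp₂ hp₃ h₁ h₂ h₃ hbits
  obtain ⟨hr1, hrk, hsha, hiff⟩ :=
    rankOne_sha_bsdp_two_iff_congruentNumberCurve_two_mul_pqr_of_aoki hGZK hAo hp₁ hp₂ hp₃ h12 h13 h23 hn6 hs hx0 hx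
  exact ⟨hr1, hrk, hsha, hiff.mpr hv⟩

/-- **The `(1, 3, 5)` family on Aoki's theorem**: for primes `p₁ ≡ 1`, `p₂ ≡ 3`, `p₃ ≡ 5 (mod 8)`, `(p₂/p₁) ≠ (p₃/p₁)`:
`ord_{s=1} L = 1`, rank `1`, `Ш[2^∞] = 0`, `BSD(E_{2p₁p₂p₃}, 2)`, relative to {`tyz_cmPointGaloisData`, TYZ Thm. 1.1, GZK,
Aoki Thm. 2.2}. CONDITIONAL; nothing asserted; closes no class by itself.
[cite: TianYuanZhang2017, §1 (1.1), Thm. 1.1, Thm. 3.5, §3] [cite: Aoki1999, Thm. 2.2 (p. 81)] -/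
theorem rankOne_sha_bsdp_two_two_mul_135_family_of_aoki (hCM : tyz_cmPointGaloisData) (h11 : thm11_parity_of_scriptL)
    (hGZK : rank_eq_analyticRank_of_analyticRank_le_one) (hAo : thm22_card_selmerGroup_two) :
    ∀ p₁ p₂ p₃ : ℕ, p₁.Prime → p₂.Prime → p₃.Prime → p₁ % 8 = 1 → p₂ % 8 = 3 → p₃ % 8 = 5 →
      jacobiSym (p₂ : ℤ) p₁ ≠ jacobiSym (p₃ : ℤ) p₁ →
      (congruentNumberCurve (2 * (p₁ * p₂ * p₃))).analyticRank = 1 ∧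
        (congruentNumberCurve (2 * (p₁ * p₂ * p₃))).mordellWeilRank = 1 ∧
        AddCommGroup.primaryComponent (congruentNumberCurve (2 * (p₁ * p₂ * p₃))).sha 2 = ⊥ ∧
        BSDp (congruentNumberCurve (2 * (p₁ * p₂ * p₃))) 2 :=
  fun _ _ _ hp₁ hp₂ hp₃ h₁ h₂ h₃ hj =>
    rankOne_sha_bsdp_two_two_mul_135_of_aoki hCM h11 hGZK hAo hp₁ hp₂ hp₃ h₁ h₂ h₃
      (bits_135_of_jacobiSym hp₁ hp₂ hp₃ h₁ h₂ h₃ hj)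

end ThetaDescent

end Summit.BirchSwinnertonDyer.Rank1Residual.P2

end
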